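import Mathlib
import Summits.Ventures.FusionMHD.Models.CerfonFreidbergIterLikeQHalfShearDefs
import HarnessLib

/-!
# Ventures/FusionMHD — Models/CerfonFreidbergIterLikeQHalfShearPanels2.lean: KERNEL CHECK of the shear-register certificates of panels 2, 3 (of 32)
# at `ψ_N = 1/2` of THE Cerfon–Freidberg ITER-like instance

HONEST FRAMING (LADDER-GRIDFUSION three columns; CF rung; successor step of «q′(ψ_N = 1/2) on the CF rung», F2-SCOPING v1.6 §10(c)).  One `decide +kernel`
(≈ 80 s): for each listed panel the obligation `CFIterLike.QHalfShear.ShearCert.ok` (`Models/CerfonFreidbergIterLikeQHalfShearDefs.lean`) — the Taylor-model run of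
`progQ = CFIterLike.QHalf.progA ++ blockQ` over ★ #117's parameter box is ACCEPTED and the kernel's panel-integral enclosure of the shear kernel `K·p` along the
approximant lies inside the claimed integers (read off a compiled `#eval` of the same functions, slack one unit of `2⁻⁶⁰`; float truth inside every panel).
MODELLED: analytic Cerfon–Freidberg family; nothing about a device or stability.  No `native_decide`.  Typer/prover: gridfusion-model-5 (g8), 2026-08-27.
Citations: Freidberg 2014 §6.3.5 (6.35) [Freidberg2014]; Mahboubi–Melquiond–Sibut-Pinote 2016 §3.2 Lemma 3 [MahboubiMelquiondSibutpinote2016].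
-/

namespace Summit.Ventures.FusionMHD.Models.CFIterLike.QHalfShear

/-- Shear-register certificate data of panels 2, 3. [instance data] -/
def shearCert2 : List ShearCert := [
  { j := 2, cand := [98564699531487903744, 106710486920901279744, 754663374828730449920, 959766082141159686144, 3761982538968425037824, 5708279244933533007872, 16654010334320818913280, 28516058007295039111168, 275486811546701579419648, -5838272930158091972902912, -806652187105551092606304256, 9852798187344104227522740224, 1146403882677143825407945998336],
    deg := 10, elog2 := 41, plo := -923452137054937592, phi := -923452064533524525 },
  { j := 3, cand := [102669442153894166528, 157178384837591400448, 868683854075118092288, 1496968424831999016960, 4932185660309670723584, 9521492167560779530240, 24755227933662070702080, 48348918680470673162240, 73558803114719881199616, -138536340638979141402624, 219073774705746855795359744, 580838129332217855529189376, -389529286622645669350036471808],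
    deg := 10, elog2 := 41, plo := -962945124642757041, phi := -962945050696210508 }]

/-- **KERNEL CHECK** of the shear register on panels 2, 3. -/
theorem shearCert2_ok : CFIterLike.QHalfShear.shearCert2.all ShearCert.ok = true := by
  decide +kernel

end Summit.Ventures.FusionMHD.Models.CFIterLike.QHalfShear
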